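import Summits.HodgeConjecture.HodgeConjecture.Theorems.CyclicUnitaryPowersEigenHodgeOfGeometricGenus
import Summits.HodgeConjecture.HodgeConjecture.Theorems.CyclicUnitaryPowersJacobianHilbertIdentities
import Literature.AlgebraicGeometry.HodgeTheory.SmoothHypersurfaceGeometricGenusLowerBound

/-!
# Route `CyclicUnitaryPowers`, crux K1-A (stmt-HodgeConjecture-19544): the binder
# `carlsonToledo1999_finrank_eigenspace_inf_hodgePiece` (all eigen-Hodge numbers of the deck transformation)
# at PRIME `p ≥ 5`, from two printed NUMBERS — the geometric genus and the second Betti number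

`carlsonToledo1999_finrank_eigenspace_inf_hodgePiece` (CT2; Carlson–Toledo 1999 §5 with Griffiths / Voisin II
Cor. 6.12): `dim_ℂ (H²(X_F)_{ζ^i} ∩ H^{2−q,q}) = dim R_f^{(q+1)p−3−i}` for the smooth `p`-cyclic covers
`X_F : x₃^p = f`. Until now the tree derived it only from the full residue-kernel package
`Griffiths1969_residueKernel_eq_jacobianIdeal` (pole orders `1, 2, 3`). This file PROVES it, for `p` prime and
`p ≥ 5` (the route uses `p ≥ 7`), in the binder's EXACT spelling, from

* `h^{2,0}(X_F) ≤ dim S₄^{p−4}` — supplied by the named fact `Arapura2012_hypersurface_geometricGenus`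
  (`h^{n,0}` of a smooth hypersurface `= C(d−1,n+1)`; its `≥` half is the tree's `choose_le_geometricGenus`), and
* `b₂(X_F) = p³ − 4p² + 6p − 2` — the named fact `EisenbudHarris2016_surface_secondBettiNumber`,

everything else being theorems: Griffiths' residues at pole order one (`GriffithsResiduesPoleOrderOne{,Exact}`),
Hodge symmetry and Galois equidistribution of eigenspaces (Shioda 1981), the invariant line
(`carlsonToledo1999_finrank_eigenspace_deck_one_holds`), and the two Hilbert-function identities of the complete
intersection `R_f` (`CyclicUnitaryPowersJacobianHilbertIdentities`).

* `finrank_eigenspace_inf_hodgePiece_of_two_numbers` — CT2's conclusion for one `(p, f)` from the two numbers;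
* `finrank_eigenspace_inf_hodgePiece_prime_of_facts` — the same from the two named facts.

CONDITIONAL (two numerical print facts); rung F-H1 not moved; nothing here says HC ∕ HC_AV is proved.
References: Carlson–Toledo, Duke Math. J. 97 (1999) §5; Arapura (2012) §17.3 (17.3.1); Eisenbud–Harris (2016)
Example 5.24; Voisin, Hodge Theory II (2003) §6.1.3 Cor. 6.12; Shioda, Ann. Sci. ÉNS 14 (1981) §§1–2.
-/

noncomputable section

open CategoryTheory AlgebraicGeometry MvPolynomial

-- mandated namespace `Summit.HodgeConjecture.HodgeConjecture.Theorems` trips `linter.dupNamespace` (off tree-wide)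
set_option linter.dupNamespace false

namespace Summit.HodgeConjecture.HodgeConjecture.Theorems.CyclicUnitaryPowersEigenHodgeNumbersOfTwoNumbers

open Literature.AlgebraicGeometry.Motives Literature.AlgebraicGeometry.HodgeTheory
open Literature.RingTheory.MvPolynomial (idealDegree)
open Summit.HodgeConjecture.HodgeConjecture.Theorems.CyclicUnitaryPowersCyclicCoverIrreducible
  (isHomogeneous_cyclicCoverForm)
open Summit.HodgeConjecture.HodgeConjecture.Theorems.CyclicUnitaryPowersEigenHodgeOfGeometricGenus
open Summit.HodgeConjecture.HodgeConjecture.Theorems.CyclicUnitaryPowersJacobianHilbertIdentities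

variable {p : ℕ} {f : MvPolynomial (Fin 3) ℂ}

/-- **CT2 from two numbers.** For `p` prime, `p ≥ 5`, `f ≠ 0` a ternary form of degree `p` with `X_F = V₊(x₃^p − f)`
smooth projective and deck transformation `σ_F`, GRANTED `h^{2,0}(X_F) ≤ dim S₄^{p−4}` and
`b₂(X_F) = p³ − 4p² + 6p − 2`: for `1 ≤ i ≤ p − 1` and `q ≤ 2`,
`dim_ℂ (H²(X_F)_{ζ^i} ∩ H^{2−q,q}) = dim S₃^{(q+1)p−3−i} − dim J_f^{(q+1)p−3−i}` (`0` if `(q+1)p < 3 + i`) — the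
conclusion of `carlsonToledo1999_finrank_eigenspace_inf_hodgePiece` verbatim. `q = 0`: residues at pole order one
exhaust `H^{2,0}` (`finrank_eigenspace_inf_hodgePiece_two_zero_eq`); `q = 2`: Hodge symmetry + Gorenstein
symmetry of `R_f` (`…_zero_two_eq`, `hilbert_jacobianIdeal_symm`); `q = 1`: the eigenspace has dimension
`p² − 3p + 3` and splits along the Hodge decomposition (`…_one_one_eq`), and
`dim R_f^{p−3−i} + dim R_f^{2p−3−i} + dim R_f^{3p−3−i} = p² − 3p + 3` (`hilbert_jacobianIdeal_three_term`).
[cite: CarlsonToledo1999, §5 (held text p0011–p0012)] [cite: VoisinHodgeII2003, §6.1.3 Cor. 6.12] -/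
theorem finrank_eigenspace_inf_hodgePiece_of_two_numbers (hHD : exists_isReal_hodgeModel) (hp : p.Prime)
    (hp5 : 5 ≤ p) (hf : f.IsHomogeneous p) (hf0 : f ≠ 0)
    (hX : IsSmoothProjective 2 (SmoothHypersurface.hypersurface (cyclicCoverForm p f)))
    (ha : deckUnit p ∈ diagonalStabilizer (cyclicCoverForm p f))
    (hpg : Module.finrank ℂ ↥((BettiUniverse.hodge hHD hX 2).piece 2 0) ≤
      Module.finrank ℂ ↥(homogeneousSubmodule (Fin 4) ℂ (p - 4)))
    (hb2 : Module.finrank ℚ ↥(bettiCohomology (SmoothHypersurface.hypersurface (cyclicCoverForm p f)) 2) =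
      p ^ 3 + 6 * p - (4 * p ^ 2 + 2))
    (i q : ℕ) (hi : 1 ≤ i) (hip : i < p) (hq : q ≤ 2) :
    Module.finrank ℂ ↥(Module.End.eigenspace
        ((BettiUniverse.pull (diagonalAut (cyclicCoverForm p f) ha) 2).baseChange ℂ)
        (Complex.exp (2 * (Real.pi : ℂ) * Complex.I / (p : ℂ)) ^ i) ⊓
      (BettiUniverse.hodge hHD hX 2).piece ((2 : ℤ) - q) q) =
    if (q + 1) * p < 3 + i then 0 else
      Module.finrank ℂ ↥(homogeneousSubmodule (Fin 3) ℂ ((q + 1) * p - 3 - i)) -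
        Module.finrank ℂ ↥(idealDegree (UniversalHypersurface.jacobianIdeal f) ((q + 1) * p - 3 - i)) := by
  have hp3 : 3 ≤ p := by omega
  have hp4 : 4 ≤ p := by omega
  interval_cases q
  · -- q = 0
    rw [Nat.cast_zero, sub_zero, zero_add, one_mul]
    exact finrank_eigenspace_inf_hodgePiece_two_zero_eq hHD hp4 hf hf0 hX ha hpg hi hip
  · -- q = 1
    have h11 := finrank_eigenspace_inf_hodgePiece_one_one_eq hHD hp hp5 hf hf0 hX ha hpg hb2 hi hip
    have h3 := hilbert_jacobianIdeal_three_term hp3 hf hf0 hX hi hip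
    have hsym := hilbert_jacobianIdeal_symm hp3 hf hf0 hX hip
    rw [hsym] at h3
    rw [Nat.cast_one, show (2 : ℤ) - 1 = 1 by norm_num, show (1 + 1) * p = 2 * p by ring, h11,
      if_neg (show ¬ (2 * p < 3 + i) by omega)]
    omega
  · -- q = 2
    have h02 := finrank_eigenspace_inf_hodgePiece_zero_two_eq hHD hp4 hf hf0 hX ha hpg hi hip
    rw [← hilbert_jacobianIdeal_symm hp3 hf hf0 hX hip] at h02
    have e : ((2 : ℤ) - ((2 : ℕ) : ℤ)) = 0 := by norm_num
    rw [e, show (2 + 1) * p = 3 * p by ring, if_neg (show ¬ (3 * p < 3 + i) by omega)]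
    exact h02

/-- **CT2 at prime `p ≥ 5` from the two named facts** `Arapura2012_hypersurface_geometricGenus` (geometric genus of
a smooth hypersurface) and `EisenbudHarris2016_surface_secondBettiNumber` (`b₂` of a smooth surface in `ℙ³`): the
statement of `carlsonToledo1999_finrank_eigenspace_inf_hodgePiece` with `p` prime and `p ≥ 5` — which is how the
route's crux K1-A consumes it (`p` prime, `p ≥ 7`). [cite: CarlsonToledo1999, §5 (held text p0011–p0012)]
[cite: Arapura2012, §17.3 (17.3.1)] [cite: EisenbudHarris2016, Example 5.24 and Table 5.1] -/
theorem finrank_eigenspace_inf_hodgePiece_prime_of_facts (hA : Arapura2012_hypersurface_geometricGenus)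
    (hB : EisenbudHarris2016_surface_secondBettiNumber) (hHD : exists_isReal_hodgeModel) (hp : p.Prime)
    (hp5 : 5 ≤ p) (f : MvPolynomial (Fin 3) ℂ) (hf : f.IsHomogeneous p) (hf0 : f ≠ 0)
    (hX : IsSmoothProjective 2 (SmoothHypersurface.hypersurface (cyclicCoverForm p f)))
    (ha : deckUnit p ∈ diagonalStabilizer (cyclicCoverForm p f))
    (i q : ℕ) (hi : 1 ≤ i) (hip : i < p) (hq : q ≤ 2) :
    Module.finrank ℂ ↥(Module.End.eigenspace
        ((BettiUniverse.pull (diagonalAut (cyclicCoverForm p f) ha) 2).baseChange ℂ)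
        (Complex.exp (2 * (Real.pi : ℂ) * Complex.I / (p : ℂ)) ^ i) ⊓
      (BettiUniverse.hodge hHD hX 2).piece ((2 : ℤ) - q) q) =
    if (q + 1) * p < 3 + i then 0 else
      Module.finrank ℂ ↥(homogeneousSubmodule (Fin 3) ℂ ((q + 1) * p - 3 - i)) -
        Module.finrank ℂ ↥(idealDegree (UniversalHypersurface.jacobianIdeal f) ((q + 1) * p - 3 - i)) := by
  have hF : (cyclicCoverForm p f).IsHomogeneous p := isHomogeneous_cyclicCoverForm hf
  have hJ := CyclicCoverFormNonsingular.isNonsingularForm_cyclicCoverForm_of_isSmoothProjective (by omega) hf hf0 hX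
  have hpg' := finrank_piece_le_finrank_homogeneousSubmodule_of_geometricGenus hA hHD (n := 2) (by norm_num)
    (by omega) hF hJ hX
  have hpg : Module.finrank ℂ ↥((BettiUniverse.hodge hHD hX 2).piece 2 0) ≤
      Module.finrank ℂ ↥(homogeneousSubmodule (Fin 4) ℂ (p - 4)) := by
    rw [show p - (2 + 2) = p - 4 by omega] at hpg'
    exact_mod_cast hpg'
  have hb2 := hB (d := p) (by omega) (cyclicCoverForm p f) hF hJ hX
  exact finrank_eigenspace_inf_hodgePiece_of_two_numbers hHD hp hp5 hf hf0 hX ha hpg hb2 i q hi hip hq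

end Summit.HodgeConjecture.HodgeConjecture.Theorems.CyclicUnitaryPowersEigenHodgeNumbersOfTwoNumbers

end
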